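/-
Copyright: the b2b-balaban T⁴-continuum CRUX team, row NE7b OWNER lineage `t4-ne7b-p1` (gen 124). Project licence.
-/
import Summits.QuantumFields.BalabanUV.T4Continuum.Spine.NE7b.SupZdPerturbedColumn
import Summits.QuantumFields.BalabanUV.T4Continuum.Spine.NE7b.SupZdCoarseInverseSumRule

/-!
# THE NEXT-SCALE MASS OF THE `H + K` COLUMN: at a CONSTANT background `V ≡ v ∈ [−λ, Λ]` (`d ≥ 3`, every mesh) and a kernel
# `|K(p,q)| ≤ εe^{−γ|p − q|₁}` under (222)'s three smallness conditions, the rows of `M = T⁻¹` sum to `a + v` EXACTLY ((208)) and the rows of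
# `N_K = T_K⁻¹` sum to `a + v + O(ε)`: `|Σ′_cN_K(b,c) − (a + v)| ≤ 2C_M′θ_NK_ν` — the zero-momentum value of the perturbed next-scale Hessian,
# i.e. the curvature of the next-scale effective potential, is Lipschitz in `K`; all of (222) re-exported at `V ≡ v` (row NE7b, node U5c;
# (189)∕(208)∕(222) BY NAME; [folklore])

Cell `pub-balaban`, sub-cell `t4`, spine estimate NE7b (`T4WeightBudget.RelWeightBound`; the cell's OWN estimate — NOT PRINTED in
[Bałaban 1983–89], NOT PROVED).  Crux-route work under `Spine/NE7b/` by the row OWNER (`t4-ne7b-p1` gen 124, file (230)) under FREEZE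
(0)'s crux-prover clause; NOTHING of Bałaban's is named as a Lean object, valued or asserted; no `T4Continuum/Support` leaf typed; no `def`,
no notation; zero `sorry`.  Imports (BY NAME): the OWNER's (222) `…SupZdPerturbedColumn` (`zd_perturbed_column`, `K_pos`), (208)
`…SupZdCoarseInverseSumRule` (`zd_coarse_inverse_sum_rule`), (189) `summable_exp_l1`, `tsum_exp_l1_le`; Mathlib's `Summable.tsum_sub`,
`norm_tsum_le_tsum_norm`.

WHY (located).  The relative weight bound (NE7b) compares effective actions at the next scale with and without the small nonlocal part;
their quadratic parts are `(n+1)^dN_K` and `(n+1)^dM`, and at a constant background the MASS TERM is the row sum.  (208) computed it exactly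
for `K = 0` (`Σ′M = a + v`: no curvature renormalisation beyond the block volume); this file adds the `O(ε)` statement for `K ≠ 0` — the
row of `N_K − M` is dominated by `2C_M′θ_Ne^{−ν|b−c|₁}` ((222) (C)), summable with sum `≤ 2C_M′θ_NK_ν` ((189)).

WHAT IS PROVED ([folklore]): §1 **`zd_perturbed_sum_rule`** (THE END: `∃ C₀ C_P δ₀ c₁ δ₁ > 0`: for ALL `n`, constant backgrounds `v`,
`ε, γ, μ, ν` with the three smallness conditions, every `K` of the class: `∃ Ψ Ψ^K M N` with ALL clauses of (222) at `V ≡ v`, AND (D): row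
summability with `Σ′M(b,·) = a + v` and `|Σ′N_K(b,·) − (a + v)| ≤ 2C_M′θ_NK_ν`); §2 toy.

HONEST (what this is NOT).  Constant backgrounds only (for general `V` there is no closed form even at `K = 0`); no statement about the
full next-scale action (only the linear column's quadratic part); no torus → `ℤ^d` limit; THREE smallness conditions with the sup road's
constants — NOT (163)'s energy threshold; `d ≥ 3` only; scalar skeleton ((A3), NC-NE7b-α UNRULED); nothing of the covariant propagators of
[B4]–[B6]; nothing of Bałaban's asserted.  BY-NAME EFFECT ON THE WALL: NONE.  NE7b NOT PRINTED ∕ NOT PROVED; spine PROVED 0∕9; rung (B)+1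
— the programme's measures remain FINITE-torus statements; NOT the mass gap, NOT Clay.  HONEST DEPENDENCY: continuum YM on T⁴ ⇐ BetaPertH ∧
nine spine estimates (0∕9 proved); BetaPertH ⇐ (D1) ∧ (D4) ∧ CAP+tail; G-an2-4 gates asym, D1 and NE2∕3∕4.
-/

set_option autoImplicit false

noncomputable section

namespace Summit.QuantumFields.BalabanUV.T4Continuum.NE7b.SupZdPerturbedSumRule

open Real Filter Topology
open scoped ENNReal
open Literature.MathematicalPhysics.QuantumFieldTheory.Balaban1983to89
open B6QGQLower276 (X e blk B)
open SupZdExponentialSums (summable_exp_l1 tsum_exp_l1_le)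
open SupZdCoarseInverseSumRule (zd_coarse_inverse_sum_rule)
open SupZdPerturbedColumn (K_pos zd_perturbed_column)

variable {d : ℕ}

/-! ## §1. THE END: the next-scale mass of the `H + K` column at a constant background -/

/-- **HEADLINE — THE NEXT-SCALE MASS IS LIPSCHITZ IN `K`**: at a CONSTANT background `V ≡ v ∈ [−λ, Λ]`, with (222)'s objects and merged
constants (all clauses of (222) re-exported with `V ≡ v`), additionally: the rows of `M = T⁻¹` sum to `a + v` EXACTLY ((208)), the rows of
`N_K = T_K⁻¹` converge absolutely and `|Σ′_cN_K(b,c) − (a + v)| ≤ 2C_M′θ_NK_ν` (`θ_N ∝ ε`) — the zero-momentum value of the perturbed next-scale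
Hessian `(n+1)^dN_K`, i.e. the curvature of the next-scale effective potential, moves by `O(ε)` under the nonlocal perturbation; (222)'s
`|N_K − M|` bound summed with (189). [folklore] -/
theorem zd_perturbed_sum_rule (hd : 3 ≤ d) (a : ℝ) (ha : 0 < a) {lam Lam : ℝ} (hlam : lam < min 2 a) (hLam : 0 ≤ Lam) :
    ∃ C₀ CP δ₀ c₁ δ₁ : ℝ, 0 < C₀ ∧ 0 < CP ∧ 0 < δ₀ ∧ 0 < c₁ ∧ 0 < δ₁ ∧
    ∀ (n : ℕ) (v : ℝ), -lam ≤ v → v ≤ Lam →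
    ∀ (ε γ μ ν : ℝ), 0 ≤ ε → 0 < μ → μ < δ₀ → μ < γ → 0 < ν → ν < μ → ν < δ₁ →
      ε * (2 * (1 - exp (-γ))⁻¹) ^ d * C₀ ≤ 1 / 2 →
      (CP * (2 * (1 - exp (-(δ₀ - μ)))⁻¹) ^ d) * (ε * exp (μ * d) * (2 * (1 - exp (-(γ - μ)))⁻¹) ^ d) ≤ 1 / 2 →
      (c₁ * exp (ν * d) * (2 * (1 - exp (-(δ₁ - ν)))⁻¹) ^ d)
        * ((4 * (CP * (2 * (1 - exp (-(δ₀ - μ)))⁻¹) ^ d)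
            * ((CP * (2 * (1 - exp (-(δ₀ - μ)))⁻¹) ^ d) * (ε * exp (μ * d) * (2 * (1 - exp (-(γ - μ)))⁻¹) ^ d)))
          * exp (ν * d) * (2 * (1 - exp (-(μ - ν)))⁻¹) ^ d) ≤ 1 / 2 →
    ∀ (K : X d → X d → ℝ), (∀ p q, |K p q| ≤ ε * exp (-(γ * ∑ i, (((p i - q i).natAbs : ℕ) : ℝ)))) →
    ∃ Ψ ΨK M N : X d → X d → ℝ,
      -- (A) the block columns
      (∀ c p, ((n : ℝ) + 1) ^ 2 * ∑ μ', (2 * Ψ c p - Ψ c (p + e μ') - Ψ c (p - e μ'))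
        + a / ((n : ℝ) + 1) ^ d * ∑ q ∈ B n (blk n p), Ψ c q + v * Ψ c p = if blk n p = c then 1 else 0) ∧
      (∀ c p, |Ψ c p| ≤ 2 * (CP * (2 * (1 - exp (-(δ₀ - μ)))⁻¹) ^ d) * exp (-(μ * ∑ i, (((blk n p i - c i).natAbs : ℕ) : ℝ)))) ∧
      (∀ c p, ((n : ℝ) + 1) ^ 2 * ∑ μ', (2 * ΨK c p - ΨK c (p + e μ') - ΨK c (p - e μ'))
        + a / ((n : ℝ) + 1) ^ d * ∑ q ∈ B n (blk n p), ΨK c q + v * ΨK c p + ∑' q : X d, K p q * ΨK c q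
          = if blk n p = c then 1 else 0) ∧
      (∀ c p, |ΨK c p| ≤ 2 * (CP * (2 * (1 - exp (-(δ₀ - μ)))⁻¹) ^ d) * exp (-(μ * ∑ i, (((blk n p i - c i).natAbs : ℕ) : ℝ)))) ∧
      (∀ c p, |ΨK c p - Ψ c p| ≤ 4 * (CP * (2 * (1 - exp (-(δ₀ - μ)))⁻¹) ^ d)
        * ((CP * (2 * (1 - exp (-(δ₀ - μ)))⁻¹) ^ d) * (ε * exp (μ * d) * (2 * (1 - exp (-(γ - μ)))⁻¹) ^ d))
        * exp (-(μ * ∑ i, (((blk n p i - c i).natAbs : ℕ) : ℝ)))) ∧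
      (∀ b c, |(((n : ℝ) + 1) ^ d)⁻¹ * ∑ q ∈ B n b, ΨK c q - (((n : ℝ) + 1) ^ d)⁻¹ * ∑ q ∈ B n b, Ψ c q|
        ≤ 4 * (CP * (2 * (1 - exp (-(δ₀ - μ)))⁻¹) ^ d)
          * ((CP * (2 * (1 - exp (-(δ₀ - μ)))⁻¹) ^ d) * (ε * exp (μ * d) * (2 * (1 - exp (-(γ - μ)))⁻¹) ^ d))
          * exp (-(μ * ∑ i, (((b i - c i).natAbs : ℕ) : ℝ)))) ∧
      -- (B) the inverse of the coarse operator
      (∀ b b' : X d, Tendsto (fun R : ℕ =>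
        if h : b ∈ (Fintype.piFinset fun _ : Fin d => Finset.Icc (-(R : ℤ)) R) ∧
            b' ∈ (Fintype.piFinset fun _ : Fin d => Finset.Icc (-(R : ℤ)) R)
          then (Matrix.of fun c c' : ↥(Fintype.piFinset fun _ : Fin d => Finset.Icc (-(R : ℤ)) R) =>
            (((n : ℝ) + 1) ^ d)⁻¹ * ∑ q ∈ B n (c : X d), Ψ (c' : X d) q)⁻¹ ⟨b, h.1⟩ ⟨b', h.2⟩ else 0)
        atTop (𝓝 (M b b'))) ∧
      (∀ b c, |M b c| ≤ c₁ * exp (-(δ₁ * ∑ i, (((b i - c i).natAbs : ℕ) : ℝ)))) ∧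
      (∀ b c, M b c = M c b) ∧
      (∀ b c, ∑' b' : X d, ((((n : ℝ) + 1) ^ d)⁻¹ * ∑ q ∈ B n b, Ψ b' q) * M b' c = if b = c then 1 else 0) ∧
      (∀ b c, ∑' b' : X d, M b b' * ((((n : ℝ) + 1) ^ d)⁻¹ * ∑ q ∈ B n b', Ψ c q) = if b = c then 1 else 0) ∧
      -- (C) the inverse of the perturbed coarse operator
      (∀ b c, |N b c| ≤ 2 * (c₁ * exp (ν * d) * (2 * (1 - exp (-(δ₁ - ν)))⁻¹) ^ d) * exp (-(ν * ∑ i, (((b i - c i).natAbs : ℕ) : ℝ)))) ∧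
      (∀ b c, Summable (fun b' : X d => ((((n : ℝ) + 1) ^ d)⁻¹ * ∑ q ∈ B n b, ΨK b' q) * N b' c) ∧
        ∑' b' : X d, ((((n : ℝ) + 1) ^ d)⁻¹ * ∑ q ∈ B n b, ΨK b' q) * N b' c = if b = c then 1 else 0) ∧
      (∀ b c, Summable (fun b' : X d => N b b' * ((((n : ℝ) + 1) ^ d)⁻¹ * ∑ q ∈ B n b', ΨK c q)) ∧
        ∑' b' : X d, N b b' * ((((n : ℝ) + 1) ^ d)⁻¹ * ∑ q ∈ B n b', ΨK c q) = if b = c then 1 else 0) ∧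
      (∀ b c, |N b c - M b c| ≤ 2 * (c₁ * exp (ν * d) * (2 * (1 - exp (-(δ₁ - ν)))⁻¹) ^ d)
        * ((c₁ * exp (ν * d) * (2 * (1 - exp (-(δ₁ - ν)))⁻¹) ^ d)
          * ((4 * (CP * (2 * (1 - exp (-(δ₀ - μ)))⁻¹) ^ d)
              * ((CP * (2 * (1 - exp (-(δ₀ - μ)))⁻¹) ^ d) * (ε * exp (μ * d) * (2 * (1 - exp (-(γ - μ)))⁻¹) ^ d)))
            * exp (ν * d) * (2 * (1 - exp (-(μ - ν)))⁻¹) ^ d))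
        * exp (-(ν * ∑ i, (((b i - c i).natAbs : ℕ) : ℝ)))) ∧
      (∀ (N' : X d → X d → ℝ) (C' ν' : ℝ), 0 ≤ C' → 0 < ν' →
        (∀ b c, |N' b c| ≤ C' * exp (-(ν' * ∑ i, (((b i - c i).natAbs : ℕ) : ℝ)))) →
        ((∀ b c, ∑' b' : X d, ((((n : ℝ) + 1) ^ d)⁻¹ * ∑ q ∈ B n b, ΨK b' q) * N' b' c = if b = c then 1 else 0) →
          ∀ b c, N' b c = N b c) ∧
        ((∀ b c, ∑' b' : X d, N' b b' * ((((n : ℝ) + 1) ^ d)⁻¹ * ∑ q ∈ B n b', ΨK c q) = if b = c then 1 else 0) →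
          ∀ b c, N' b c = N b c)) ∧
      -- (D) the next-scale mass at a constant background: `Σ′M = a + v` exactly, `Σ′N_K = a + v + O(ε)`
      (∀ b, (Summable fun c : X d => M b c) ∧ ∑' c : X d, M b c = a + v) ∧
      (∀ b, (Summable fun c : X d => N b c) ∧
        |∑' c : X d, N b c - (a + v)| ≤ 2 * (c₁ * exp (ν * d) * (2 * (1 - exp (-(δ₁ - ν)))⁻¹) ^ d)
          * ((c₁ * exp (ν * d) * (2 * (1 - exp (-(δ₁ - ν)))⁻¹) ^ d)
            * ((4 * (CP * (2 * (1 - exp (-(δ₀ - μ)))⁻¹) ^ d)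
                * ((CP * (2 * (1 - exp (-(δ₀ - μ)))⁻¹) ^ d) * (ε * exp (μ * d) * (2 * (1 - exp (-(γ - μ)))⁻¹) ^ d)))
              * exp (ν * d) * (2 * (1 - exp (-(μ - ν)))⁻¹) ^ d))
          * (2 * (1 - exp (-ν))⁻¹) ^ d) := by
  classical
  obtain ⟨C₀, CP, δ₀, c₁, δ₁, hC₀, hCP, hδ₀, hc₁, hδ₁, H222⟩ := zd_perturbed_column (d := d) hd a ha hlam hLam
  refine ⟨C₀, CP, δ₀, c₁, δ₁, hC₀, hCP, hδ₀, hc₁, hδ₁, ?_⟩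
  intro n v hv hv' ε γ μ ν hε hμ hμδ hμγ hν hνμ hνδ hsmall1 hsmall2 hsmall3 K hK
  obtain ⟨Ψ, ΨK, M, N, hA1, hA2, hA3, hA4, hA5, hA6, hB1, hB2, hB3, hB4, hB5, hC1, hC2, hC3, hC4, hC5⟩ :=
    H222 n (fun _ => v) (fun _ => hv) (fun _ => hv') ε γ μ ν hε hμ hμδ hμγ hν hνμ hνδ hsmall1 hsmall2 hsmall3 K hK
  refine ⟨Ψ, ΨK, M, N, hA1, hA2, hA3, hA4, hA5, hA6, hB1, hB2, hB3, hB4, hB5, hC1, hC2, hC3, hC4, hC5, ?_, ?_⟩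
  · -- (208) for this `M`: the block columns are bounded by their decay constant
    intro b
    have hK0 : 0 < (2 * (1 - exp (-(δ₀ - μ)))⁻¹) ^ d := K_pos (d := d) (sub_pos.2 hμδ)
    have hΨB : ∀ c p, |Ψ c p| ≤ 2 * (CP * (2 * (1 - exp (-(δ₀ - μ)))⁻¹) ^ d) := fun c p =>
      (hA2 c p).trans (mul_le_of_le_one_right (by positivity) (exp_le_one_iff.2 (neg_nonpos.2 (by positivity))))
    exact (zd_coarse_inverse_sum_rule (d := d) hd a ha hlam hLam n v hv hv' Ψ (fun _ => 2 * (CP * (2 * (1 - exp (-(δ₀ - μ)))⁻¹) ^ d))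
      hΨB hA1 M hB1 b).2
  · intro b
    have hK1 : 0 < (2 * (1 - exp (-(δ₁ - ν)))⁻¹) ^ d := K_pos (d := d) (sub_pos.2 hνδ)
    have hK0 : 0 < (2 * (1 - exp (-(δ₀ - μ)))⁻¹) ^ d := K_pos (d := d) (sub_pos.2 hμδ)
    have hΨB : ∀ c p, |Ψ c p| ≤ 2 * (CP * (2 * (1 - exp (-(δ₀ - μ)))⁻¹) ^ d) := fun c p =>
      (hA2 c p).trans (mul_le_of_le_one_right (by positivity) (exp_le_one_iff.2 (neg_nonpos.2 (by positivity))))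
    obtain ⟨hMs, hMsum⟩ := (zd_coarse_inverse_sum_rule (d := d) hd a ha hlam hLam n v hv hv' Ψ
      (fun _ => 2 * (CP * (2 * (1 - exp (-(δ₀ - μ)))⁻¹) ^ d)) hΨB hA1 M hB1 b).2
    -- abbreviation for the `O(ε)` constant of (222) (C)
    obtain ⟨D, hD⟩ : ∃ D : ℝ, D = 2 * (c₁ * exp (ν * d) * (2 * (1 - exp (-(δ₁ - ν)))⁻¹) ^ d)
        * ((c₁ * exp (ν * d) * (2 * (1 - exp (-(δ₁ - ν)))⁻¹) ^ d)
          * ((4 * (CP * (2 * (1 - exp (-(δ₀ - μ)))⁻¹) ^ d)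
              * ((CP * (2 * (1 - exp (-(δ₀ - μ)))⁻¹) ^ d) * (ε * exp (μ * d) * (2 * (1 - exp (-(γ - μ)))⁻¹) ^ d)))
            * exp (ν * d) * (2 * (1 - exp (-(μ - ν)))⁻¹) ^ d)) := ⟨_, rfl⟩
    have hKγμ : 0 < (2 * (1 - exp (-(γ - μ)))⁻¹) ^ d := K_pos (d := d) (sub_pos.2 hμγ)
    have hKμν : 0 < (2 * (1 - exp (-(μ - ν)))⁻¹) ^ d := K_pos (d := d) (sub_pos.2 hνμ)
    have hD0 : 0 ≤ D := by rw [hD]; positivity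
    rw [← hD] at hC4 ⊢
    -- the difference `N − M` is summable along the row and its sum is at most `D·K_ν`
    have hdiff : ∀ c, |N b c - M b c| ≤ D * exp (-(ν * ∑ i, (((b i - c i).natAbs : ℕ) : ℝ))) := fun c => hC4 b c
    have hds : Summable fun c : X d => N b c - M b c :=
      Summable.of_norm_bounded ((summable_exp_l1 hν b).mul_left D) fun c => by rw [Real.norm_eq_abs]; exact hdiff c
    have hNs : Summable fun c : X d => N b c := (hds.add hMs).congr fun c => by ring
    refine ⟨hNs, ?_⟩
    have e : ∑' c : X d, N b c - (a + v) = ∑' c : X d, (N b c - M b c) := by rw [hNs.tsum_sub hMs, hMsum]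
    rw [e]
    have h1 : |∑' c : X d, (N b c - M b c)| ≤ ∑' c : X d, |N b c - M b c| := by
      have := norm_tsum_le_tsum_norm hds.norm; simpa only [Real.norm_eq_abs] using this
    have h2 := hds.abs.tsum_le_tsum hdiff ((summable_exp_l1 hν b).mul_left D)
    rw [tsum_mul_left] at h2
    exact h1.trans (h2.trans (mul_le_mul_of_nonneg_left (tsum_exp_l1_le hν b) hD0))

/-! ## §2. Toy -/

/-- Toy (`d = 3`, `a = 1`, `λ = 0`, `Λ = 1`): the five constants exist. -/
example : ∃ C₀ CP δ₀ c₁ δ₁ : ℝ, 0 < C₀ ∧ 0 < CP ∧ 0 < δ₀ ∧ 0 < c₁ ∧ 0 < δ₁ :=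
  let ⟨C₀, CP, δ₀, c₁, δ₁, h1, h2, h3, h4, h5, _⟩ :=
    zd_perturbed_sum_rule (d := 3) le_rfl 1 one_pos (lam := 0) (Lam := 1)
      (by rw [min_eq_right (by norm_num : (1 : ℝ) ≤ 2)]; norm_num) zero_le_one
  ⟨C₀, CP, δ₀, c₁, δ₁, h1, h2, h3, h4, h5⟩

end Summit.QuantumFields.BalabanUV.T4Continuum.NE7b.SupZdPerturbedSumRule
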